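import Mathlib
import HarnessLib
import Literature.MathematicalPhysics.QuantumFieldTheory.YangMillsOS
import Literature.MathematicalPhysics.QuantumLattice.LatticeGaugeDLR

/-!
# Sketch (crux-ideate round 2, ideator 5) — first lemmas for two idea cards on `DiagonalMirrorRPR`

Card A `kms-variance-lukewarm-descent`: §A the KMS-averaged thermal-variance inequality (finite-dimensional
form), §C uniform physical clustering of renormalised strings, §D scheme lukewarmness (purity / twist weight).
Card B `bulk-first-tangent-descent`: §E bulk (infinite-volume) swap-RP from uniqueness of the bulk limit,
negative-coupling closure on even tilted tori.
§B copies the box-torus vocabulary of `Lines/parity_bridge_cold_traces.lean` (same definitions, own namespace).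
Statements only (`def … : Prop`); nothing here is proved.
-/

open MeasureTheory Filter Topology
open scoped ComplexConjugate SchwartzMap
open Literature.Probability.LatticeModels Literature.MathematicalPhysics.QuantumLattice
  Literature.MathematicalPhysics.QuantumFieldTheory Literature.MathematicalPhysics.AQFT

noncomputable section

namespace Summit.QuantumFields.YangMills.Cruxes.DiagonalMirrorRPR.SketchIdeator5

/-! ## §A The KMS-averaged thermal-variance inequality (Card A's lever, matrix form)

For a positive semidefinite real symmetric `T` (the slice transfer matrix of Wilson's action, `β ≥ 0`), a real
symmetric `A` (an observable), an extent `N ≥ 1` (the thermal circle) and ANY probability vector `h` on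
`{0,…,N-1}` (KMS weights; choosing `h` supported away from `0` and `N` keeps only time-separated
autocorrelations): with `λᵢ, vᵢ` the eigen-data of `T` and `aᵢ = ⟨vᵢ, A vᵢ⟩` the diagonal matrix elements,
`∑ᵢ λᵢᴺ aᵢ² ≤ ∑ₙ hₙ tr(T^{N-n} A Tⁿ A)`.  Dividing by `Z = tr Tᴺ` and subtracting `(tr(Tᴺ A)/Z)²` from both sides:
the thermal VARIANCE of the diagonal matrix elements is bounded by the `h`-averaged connected thermal
autocorrelation of `A`.  (Proof: expand the right side in the eigenbasis, `∑ᵢⱼ [∑ₙ hₙ λᵢ^{N-n} λⱼⁿ] |Aᵢⱼ|²`; the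
`i = j` terms are the left side, the `i ≠ j` terms are `≥ 0` because `λ ≥ 0`.) -/
def ThermalVarianceLeKMSAverage : Prop :=
  ∀ (m : Type) [Fintype m] [DecidableEq m] (T A : Matrix m m ℝ) (hT : T.PosSemidef), A.IsSymm →
    ∀ (N : ℕ), 1 ≤ N → ∀ (h : Fin N → ℝ), (∀ n, 0 ≤ h n) → ∑ n, h n = 1 →
      (∑ i, hT.1.eigenvalues i ^ N *
          (dotProduct (⇑(hT.1.eigenvectorBasis i)) (A.mulVec ⇑(hT.1.eigenvectorBasis i))) ^ 2) ≤
        ∑ n : Fin N, h n * (T ^ (N - (n : ℕ)) * A * T ^ (n : ℕ) * A).trace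

/-- The two consequences used by the descent (same eigen-data; `p = λᴺ/Z` the thermal law, `ā = ∑ pᵢaᵢ`,
`Var = ∑ pᵢ aᵢ² − ā²`): (twist) for signs `uᵢ ∈ {±1}` with `Z̃ = ∑ λᵢᴺ uᵢ > 0`,
`|∑ λᵢᴺuᵢaᵢ/Z̃ − ā| ≤ (Z/Z̃)·√Var`; (doubling) `|∑ λᵢ^{2N}aᵢ/Z₂ − ā| ≤ √(Var · Z²/Z₂)`, `Z₂ = ∑ λᵢ^{2N}`.
Elementary (Cauchy–Schwarz / Chebyshev); recorded as the shape the descent stub will take. -/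
def LukewarmDescentInequalities : Prop :=
  ∀ (m : Type) [Fintype m] (w a : m → ℝ) (u : m → ℝ), (∀ i, 0 ≤ w i) → (∀ i, u i = 1 ∨ u i = -1) →
    0 < ∑ i, w i → 0 < ∑ i, w i * u i →
    let Z := ∑ i, w i
    let Zt := ∑ i, w i * u i
    let Z₂ := ∑ i, w i ^ 2
    let abar := (∑ i, w i * a i) / Z
    let var := (∑ i, w i * a i ^ 2) / Z - abar ^ 2
    |(∑ i, w i * u i * a i) / Zt - abar| ≤ Z / Zt * Real.sqrt var ∧
      |(∑ i, w i ^ 2 * a i) / Z₂ - abar| ≤ Real.sqrt (var * (Z ^ 2 / Z₂))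

/-! ## §B Box tori (copy of the skeleton's vocabulary): `ℤ_{n₀} × ℤ_{n₁} × ℤ_N²`, optionally sheared -/

abbrev TSite (n₀ n₁ N : ℕ) : Type := ZMod n₀ × ZMod n₁ × ZMod N × ZMod N
abbrev TEdge (n₀ n₁ N : ℕ) : Type := TSite n₀ n₁ N × Fin 4
abbrev TConfig (n₀ n₁ N : ℕ) (G : Type*) : Type _ := TEdge n₀ n₁ N → G

instance neZero_two_mul (N : ℕ) [NeZero N] : NeZero (2 * N) := ⟨mul_ne_zero two_ne_zero (NeZero.ne N)⟩
instance neZero_odd (S : ℕ) : NeZero (2 * S + 1) := ⟨Nat.succ_ne_zero _⟩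

section BoxTorus
variable {n₀ n₁ N : ℕ}

def tstep (shear : Bool) (i : Fin 4) : TSite n₀ n₁ N :=
  ![((1 : ZMod n₀), (0 : ZMod n₁), (0 : ZMod N), (0 : ZMod N)),
    ((if shear then -1 else 0 : ZMod n₀), (1 : ZMod n₁), (0 : ZMod N), (0 : ZMod N)),
    ((0 : ZMod n₀), (0 : ZMod n₁), (1 : ZMod N), (0 : ZMod N)),
    ((0 : ZMod n₀), (0 : ZMod n₁), (0 : ZMod N), (1 : ZMod N))] i

variable {G : Type*} [Group G]

def tplaq (shear : Bool) (U : TConfig n₀ n₁ N G) (x : TSite n₀ n₁ N) (i j : Fin 4) : G :=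
  U (x, i) * U (x + tstep shear i, j) * (U (x + tstep shear j, i))⁻¹ * (U (x, j))⁻¹

variable {Nc : ℕ} (ρ : G →* Matrix (Fin Nc) (Fin Nc) ℂ)

def taction [NeZero n₀] [NeZero n₁] [NeZero N] (shear : Bool) (U : TConfig n₀ n₁ N G) : ℝ :=
  ∑ x : TSite n₀ n₁ N, ∑ i : Fin 4, ∑ j : Fin 4, if i < j then (ρ (tplaq shear U x i j)).trace.re else 0

def tweight [NeZero n₀] [NeZero n₁] [NeZero N] (β : ℝ) (shear : Bool) (U : TConfig n₀ n₁ N G) : ℝ :=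
  Real.exp (β * taction ρ shear U)

variable [TopologicalSpace G] [IsTopologicalGroup G] [CompactSpace G] [MeasurableSpace G] [BorelSpace G]

def thaar (n₀ n₁ N : ℕ) [NeZero n₀] [NeZero n₁] [NeZero N] : Measure (TConfig n₀ n₁ N G) :=
  Measure.pi fun _ : TEdge n₀ n₁ N => haarProbability G

def tZ (n₀ n₁ N : ℕ) [NeZero n₀] [NeZero n₁] [NeZero N] (β : ℝ) (shear : Bool) : ℝ :=
  ∫ U, tweight ρ β shear U ∂(thaar n₀ n₁ N : Measure (TConfig n₀ n₁ N G))

def texp [NeZero n₀] [NeZero n₁] [NeZero N] (β : ℝ) (shear : Bool) (F : TConfig n₀ n₁ N G → ℂ) : ℂ :=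
  (∫ U, F U * ((tweight ρ β shear U : ℝ) : ℂ) ∂(thaar n₀ n₁ N : Measure (TConfig n₀ n₁ N G))) /
    ((tZ ρ n₀ n₁ N β shear : ℝ) : ℂ)

end BoxTorus

section Cover
variable {N : ℕ} [NeZero N]

/-- Swap in the chart `(u,w) = (x₀−x₁, x₁)`: `(u,w,y,z) ↦ (−u, w+ū, y, z)`. -/
def swapSite (x : TSite (2 * N) N N) : TSite (2 * N) N N :=
  (-x.1, x.2.1 + ZMod.castHom (dvd_mul_left N 2) (ZMod N) x.1, x.2.2.1, x.2.2.2)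

def swapEdge (e : TEdge (2 * N) N N) : TEdge (2 * N) N N := (swapSite e.1, Equiv.swap (0 : Fin 4) 1 e.2)

def swapConfig {G : Type*} (U : TConfig (2 * N) N N G) : TConfig (2 * N) N N G := U ∘ swapEdge

def posEdges (N : ℕ) [NeZero N] : Set (TEdge (2 * N) N N) :=
  {e | (e.1.1).val ≤ N ∧ ((e.1 + tstep true e.2).1).val ≤ N}

variable {G : Type} [Group G] [TopologicalSpace G] [IsTopologicalGroup G] [CompactSpace G]
  [MeasurableSpace G] [BorelSpace G] {Nc : ℕ}

/-- Swap-RP of Wilson's measure on the 45° torus `T̃_N` at `(ρ, β)` (as in the skeleton). -/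
def CoverSwapRPAt (ρ : G →* Matrix (Fin Nc) (Fin Nc) ℂ) (β : ℝ) (N : ℕ) [NeZero N] : Prop :=
  ∀ F : TConfig (2 * N) N N G → ℂ, Measurable F → (∃ C : ℝ, ∀ U, ‖F U‖ ≤ C) →
    DependsOn F (posEdges N) →
      0 ≤ (texp ρ β true fun U => conj (F (swapConfig U)) * F U).re ∧
        (texp ρ β true fun U => conj (F (swapConfig U)) * F U).im = 0

def skewProj (N : ℕ) (x : Fin 4 → ℤ) : TSite (2 * N) N N :=
  (((x 0 - x 1 : ℤ) : ZMod (2 * N)), ((x 1 : ℤ) : ZMod N), ((x 2 : ℤ) : ZMod N), ((x 3 : ℤ) : ZMod N))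

def skewLift (N : ℕ) (U : TConfig (2 * N) N N G) : LGConfig 4 G := fun e => U (skewProj N e.1, e.2)

end Cover

/-! ## §C Uniform physical clustering of renormalised strings on the scheme's own tori (Card A, input 1)

Connected autocorrelation, along `e₀`, at PHYSICAL time `t`, of the renormalised curvature string smeared with
`f = (f₁,…,fₙ)`, computed on the scheme's torus at step `k`:
`conn_k(t) = ⟨Φ(f) · Φ(τ_{t e₀} f)⟩_k − ⟨Φ(f)⟩_k ⟨Φ(τ_{t e₀} f)⟩_k`, all three being `latticeSchwinger`s. -/

section Physical
variable {G : Type} [Group G] [TopologicalSpace G] [IsTopologicalGroup G] [CompactSpace G]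
  [MeasurableSpace G] [BorelSpace G]

abbrev E4 : Type := EuclideanSpace ℝ (Fin 4)

/-- Translate every test function of a string by `t e₀`. -/
def shiftString {n : ℕ} (t : ℝ) (f : Fin n → 𝓢(E4, ℝ)) : Fin n → 𝓢(E4, ℝ) :=
  fun i => translateTest (t • EuclideanSpace.single (0 : Fin 4) (1 : ℝ)) (f i)

/-- The connected `e₀`-autocorrelation of the renormalised curvature string `f` at physical time `t`, step `k`. -/
def stringConn (r : LatticeRep G) (sch : SpeciesScheme (YMSpecies G)) {n : ℕ} (f : Fin n → 𝓢(E4, ℝ))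
    (k : ℕ) (t : ℝ) : ℝ :=
  latticeSchwinger r.ρ sch (fun s => s.F) k (n + n) (fun _ => r.curvature) (Fin.append f (shiftString t f)) -
    latticeSchwinger r.ρ sch (fun s => s.F) k n (fun _ => r.curvature) f *
      latticeSchwinger r.ρ sch (fun s => s.F) k n (fun _ => r.curvature) (shiftString t f)

/-- **Uniform physical clustering (UPC).** For every renormalised curvature string with compactly supported
test functions and every `ε > 0` there is a physical time `t₀` such that, for all large `k`, the connected
`e₀`-autocorrelation on the scheme's OWN torus is `≤ ε` at every physical separation `t ∈ [t₀, ℓ_k/2]`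
(`ℓ_k = a_k (2L_k+1)`; beyond `ℓ_k/2` use the KMS symmetry `t ↔ ℓ_k − t`).  Pointwise in `t` this is
`hconv` + the continuum gap; the uniformity in `t` up to half the torus is the (rate-free, `c_k`-free) input. -/
def UniformPhysicalClustering (r : LatticeRep G) (sch : SpeciesScheme (YMSpecies G)) : Prop :=
  ∀ (n : ℕ), n ≠ 0 → ∀ (f : Fin n → 𝓢(E4, ℝ)), (∀ i, HasCompactSupport (f i)) →
    ∀ ε : ℝ, 0 < ε → ∃ t₀ : ℝ, 0 < t₀ ∧ ∀ᶠ k in atTop, ∀ t : ℝ, t₀ ≤ t →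
      t ≤ sch.a k * sch.side k / 2 → |stringConn r sch f k t| ≤ ε

/-! ## §D Scheme lukewarmness (Card A, input 2): purity and twist weight bounded below

`tZ ρ n₀ n₁ N β shear` is `Z(ℤ_{n₀}(e₀) × ℤ_{n₁}(e₁) × ℤ_N²)` (sheared: the 45° torus).  With `N = N_k`, `β = β_k`:
purity of the `e₁`-thermal state of the scheme's torus `= Z(N, 2N, N)/Z(N, N, N)²` (`= Tr 𝕋₁^{2N}/(Tr 𝕋₁^N)²`),
twist weight `= Z(T̃_N)/Z(T''_N) = Z_sheared(2N, N, N)/Z(N, 2N, N)` (`= Tr(𝕋₀^N U)/Tr 𝕋₀^N ∈ (0,1]`). -/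

variable {Nc : ℕ}

def purityE1 (ρ : G →* Matrix (Fin Nc) (Fin Nc) ℂ) (β : ℝ) (N : ℕ) [NeZero N] : ℝ :=
  tZ ρ N (2 * N) N β false / tZ ρ N N N β false ^ 2

def twistWeight (ρ : G →* Matrix (Fin Nc) (Fin Nc) ℂ) (β : ℝ) (N : ℕ) [NeZero N] : ℝ :=
  tZ ρ (2 * N) N N β true / tZ ρ N (2 * N) N β false

/-- **Scheme lukewarmness**: along the scheme, purity and twist weight stay bounded below (an `O(1)` condition;
coldness `ζ_k → 0` of the existing line is the `o(1)` condition purity `→ 1`, twist weight `→ 1`). -/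
def SchemeLukewarm {ι : Type} (ρ : G →* Matrix (Fin Nc) (Fin Nc) ℂ) (sch : SpeciesScheme ι) : Prop :=
  ∃ c : ℝ, 0 < c ∧ ∀ᶠ k in atTop, c ≤ purityE1 ρ (sch.β k) (sch.side k) ∧ c ≤ twistWeight ρ (sch.β k) (sch.side k)

/-- **First checkable statement of Card A's line** (the descent with lukewarm traces): cover swap-RP for
`β ≥ 0` + UPC (on the scheme's tori and, transported by the doubling step, on the doubled tori) + lukewarmness
⇒ the curvature strings on the scheme's torus and on its 45° cover have the same limits; with RP closed under
limits, density of off-diagonal real tensors and `hconv` this gives the crux on schemes with `∀ᶠ k, 0 ≤ β_k`.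
Stated here as the implication the crux-plan would have to skeletonise. -/
def LukewarmCoverDescent : Prop :=
  ∀ (G : Type) [Group G] [TopologicalSpace G] [IsTopologicalGroup G] [CompactSpace G] [MeasurableSpace G]
    [BorelSpace G] (r : LatticeRep G) (sch : SpeciesScheme (YMSpecies G)),
    (∀ᶠ k in atTop, 0 ≤ sch.β k) → UniformPhysicalClustering r sch → SchemeLukewarm r.ρ sch →
      ∀ (n : ℕ), n ≠ 0 → ∀ (f : Fin n → 𝓢(E4, ℝ)), (∀ i, HasCompactSupport (f i)) →
        Tendsto (fun k : ℕ =>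
          latticeSchwinger r.ρ sch (fun s => s.F) k n (fun _ => r.curvature) f -
            (texp r.ρ (sch.β k) true fun U : TConfig (2 * sch.side k) (sch.side k) (sch.side k) G =>
              ((∏ i, smearedLatticeField r.curvature.F (Literature.Probability.LatticeModels.box 4 (sch.L k))
                (sch.a k) (sch.c r.curvature k) (sch.m r.curvature k) (f i) (skewLift (sch.side k) U) : ℝ) : ℂ)).re)
          atTop (𝓝 0)

/-! ## §E Bulk-first (Card B): swap-RP of the infinite-volume state from uniqueness of the bulk limit -/

/-- The swap `x₀ ↔ x₁` on sites / positively oriented edges / configurations of `ℤ⁴`. -/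
def swapSiteZ (x : Site 4) : Site 4 := x ∘ Equiv.swap (0 : Fin 4) 1
def swapEdgeZ (e : ZdEdge 4) : ZdEdge 4 := (swapSiteZ e.1, Equiv.swap (0 : Fin 4) 1 e.2)
def diagReflect (U : LGConfig 4 G) : LGConfig 4 G := U ∘ swapEdgeZ

/-- Light-cone coordinate `u = x₀ − x₁` of a site; an edge lies in the OPEN positive half iff both endpoints have `u ≥ 1`. -/
def InOpenHalf (e : ZdEdge 4) : Prop :=
  let y : Site 4 := e.1 + Pi.single e.2 1
  1 ≤ e.1 0 - e.1 1 ∧ 1 ≤ y 0 - y 1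

/-- Expectation of an observable of `ℤ⁴`-configurations on the odd square torus of side `2S+1` (periodic lift). -/
def squareExp (ρ : G →* Matrix (Fin Nc) (Fin Nc) ℂ) (β : ℝ) (S : ℕ) (F : LGConfig 4 G → ℂ) : ℂ :=
  ∫ U, F (torusLift (2 * S + 1) U) ∂(wilsonMeasure (d := 4) (L := 2 * S + 1) ρ β)

/-- Expectation of the same observable on the 45° torus `T̃_M` (sheared chart, `Λ̃_M`-periodic lift). -/
def tiltedExp (ρ : G →* Matrix (Fin Nc) (Fin Nc) ℂ) (β : ℝ) (M : ℕ) [NeZero M] (F : LGConfig 4 G → ℂ) : ℂ :=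
  texp ρ β true fun U : TConfig (2 * M) M M G => F (skewLift M U)

/-- **Uniqueness of the bulk limit** at `(ρ, β)` (a concrete surrogate for "unique translation-invariant Gibbs
state on gauge-invariant local observables"): odd square tori and 45° tori have the same infinite-volume limits. -/
def UniqueBulk (ρ : G →* Matrix (Fin Nc) (Fin Nc) ℂ) (β : ℝ) : Prop :=
  ∀ F : YMSpecies G, ∃ c : ℝ,
    Tendsto (fun S : ℕ => (squareExp ρ β S fun U => ((F.F U : ℝ) : ℂ)).re) atTop (𝓝 c) ∧
      Tendsto (fun M : ℕ => (tiltedExp ρ β (M + 1) fun U => ((F.F U : ℝ) : ℂ)).re) atTop (𝓝 c)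

/-- **Bulk swap-RP along odd square tori**: the swap-RP form of any finite family of half-space gauge-invariant
local observables is asymptotically non-negative as `S → ∞` (the seam recedes to infinity at FIXED coupling). -/
def BulkSwapRP (ρ : G →* Matrix (Fin Nc) (Fin Nc) ℂ) (β : ℝ) : Prop :=
  ∀ (m : ℕ) (F : Fin m → YMSpecies G) (c : Fin m → ℂ), (∀ i, ∀ e ∈ (F i).supp, InOpenHalf e) →
    ∀ ε : ℝ, 0 < ε → ∀ᶠ S : ℕ in atTop,
      -ε ≤ (∑ i, ∑ j, conj (c i) * c j *
        squareExp ρ β S (fun U => (((F i).F (diagReflect U) : ℝ) : ℂ) * (((F j).F U : ℝ) : ℂ))).re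

/-- **Card B, first lemma.** `β ≥ 0` and uniqueness of the bulk limit ⇒ the odd-square-torus bulk state is
swap-RP (because the 45° tori are exactly swap-RP for `β ≥ 0` and RP passes to limits). -/
def BulkSwapRPOfUniqueBulk : Prop :=
  ∀ (G : Type) [Group G] [TopologicalSpace G] [IsTopologicalGroup G] [CompactSpace G] [MeasurableSpace G]
    [BorelSpace G] (Nc : ℕ) (ρ : G →* Matrix (Fin Nc) (Fin Nc) ℂ), Continuous ρ →
    (∀ g, ρ g ∈ Matrix.unitaryGroup (Fin Nc) ℂ) → ∀ β : ℝ, 0 ≤ β →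
      (∀ M : ℕ, [NeZero M] → 2 ≤ M → CoverSwapRPAt ρ β M) → UniqueBulk ρ β → BulkSwapRP ρ β

/-- **Card B, negative-coupling closure on EVEN tilted tori.** If `−1 ∈ ρ(Z(G))` (e.g. `SU(2)` fundamental) then
for even `M` the 45° torus `T̃_M` at coupling `−β` is the image of `T̃_M` at `β` under the Haar-preserving sign
cochain `U_e ↦ z^{ε(e)} U_e`, `ε(x,e₁) = x₀`, `ε(x,e₂) = x₀+x₁`, `ε(x,e₃) = x₀+x₁+x₂ (mod 2)`, `ε(x,e₀) = 0`
(coboundary `≡ 1` on all six plaquette types; `Λ̃_M`-periodic iff `M` is even), which commutes with the swap up to a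
`ℤ₂`-valued gauge transformation — so swap-RP at `β` gives swap-RP at `−β` on gauge-invariant half-space observables. -/
def TiltedRPNegativeCoupling : Prop :=
  ∀ (G : Type) [Group G] [TopologicalSpace G] [IsTopologicalGroup G] [CompactSpace G] [MeasurableSpace G]
    [BorelSpace G] (Nc : ℕ) (ρ : G →* Matrix (Fin Nc) (Fin Nc) ℂ),
    (∃ z ∈ Subgroup.center G, ρ z = -1) → ∀ (β : ℝ) (M : ℕ) [NeZero M], Even M →
      CoverSwapRPAt ρ β M → CoverSwapRPAt ρ (-β) M

end Physical

end Summit.QuantumFields.YangMills.Cruxes.DiagonalMirrorRPR.SketchIdeator5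

end
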